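import Literature.Computability.AlgebraicComplexity.GrenetPathPotentials

/-!
# Route RigidityForcesSymmetry — `GrenetFirstOrderRankRigid` (item stmt-ValiantsHypothesis-21029),
line `grenet_gauge`: additive potentials on the Boolean lattice (block `W0` of the blueprint for
`stub_linearRigid`)

For the crux line `Cruxes/GrenetFirstOrderRankRigid/Lines/grenet_gauge.lean` (blueprint
`Lines/grenet_gauge-stub_linearRigid-PROOF.md`, §5, block **W0**): the weight-zero block of the
tangency system has one unknown `σ_a` per arc `a = (S → insert k S)` of Grenet's branching program and
one equation per maximal chain `∅ → univ` (per ordering of `Fin n`): the `σ_a` along the chain sum to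
`0`.  This file proves the ADDITIVE twin of the tree's multiplicative coboundary lemma
`Grenet.exists_potential_of_prod_prefix_eq_one`: such a `σ` is a coboundary,
`σ_a = φ(head a) - φ(tail a)` for a potential `φ` on the subsets with `φ ∅ = φ univ = 0` — i.e. the
block's solutions are exactly the (diagonal) gauge directions.

* `sum_prefix_eq_of_eqOn_ge`, `sum_prefix_eq_of_prefix_image_eq` — path independence of the partial
  sums (splicing two orderings with the same prefix set, as in `GrenetPathPotentials`);
* `exists_addPotential_of_sum_prefix_eq_zero` — the additive potential, normalised at `∅` and `univ`.

Valid in any additive commutative group.  No new definitions.  VP ≠ VNP is not moved by this file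
(first-order bookkeeping about one explicit matrix family).
-/

noncomputable section

open Finset

namespace Summit.ValiantsHypothesis.Theorems.RigidityForcesSymmetry.GrenetGauge

open Literature.Computability.AlgebraicComplexity

variable {n : ℕ} {M : Type*} [AddCommGroup M]

/-- If all full path sums vanish, the partial path sums `Σ_{t < j} ρ (σ({i < t})) (σ t)` of two
orderings that agree from `j` on coincide (the common suffix sum cancels). [folklore] -/
theorem sum_prefix_eq_of_eqOn_ge (ρ : Finset (Fin n) → Fin n → M)
    (hρ : ∀ σ : Equiv.Perm (Fin n),
      ∑ t : Fin n, ρ ((univ.filter fun i : Fin n => (i : ℕ) < (t : ℕ)).image σ) (σ t) = 0)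
    {σ σ' : Equiv.Perm (Fin n)} {j : ℕ} (h : ∀ i : Fin n, j ≤ (i : ℕ) → σ i = σ' i) :
    ∑ t ∈ univ.filter (fun t : Fin n => (t : ℕ) < j),
        ρ ((univ.filter fun i : Fin n => (i : ℕ) < t).image σ) (σ t) =
      ∑ t ∈ univ.filter (fun t : Fin n => (t : ℕ) < j),
        ρ ((univ.filter fun i : Fin n => (i : ℕ) < t).image σ') (σ' t) := by
  have htail : ∑ t ∈ univ.filter (fun t : Fin n => ¬ (t : ℕ) < j),
        ρ ((univ.filter fun i : Fin n => (i : ℕ) < t).image σ) (σ t) =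
      ∑ t ∈ univ.filter (fun t : Fin n => ¬ (t : ℕ) < j),
        ρ ((univ.filter fun i : Fin n => (i : ℕ) < t).image σ') (σ' t) := by
    refine sum_congr rfl fun t ht => ?_
    have hjt : j ≤ (t : ℕ) := not_lt.mp (mem_filter.mp ht).2
    rw [Grenet.prefix_image_eq_of_eqOn_ge h hjt, h t hjt]
  have hσ := hρ σ
  have hσ' := hρ σ'
  rw [← sum_filter_add_sum_filter_not univ (fun t : Fin n => (t : ℕ) < j)] at hσ hσ'
  rw [htail] at hσ
  exact add_right_cancel (hσ.trans hσ'.symm)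

/-- **Path independence (additive).** If all full path sums vanish, the partial path sum
`Σ_{t < j} ρ (σ({i < t})) (σ t)` depends only on the prefix SET `σ({i < j})` (splice the two orderings:
the second below `j`, the first from `j` on). [folklore] -/
theorem sum_prefix_eq_of_prefix_image_eq (ρ : Finset (Fin n) → Fin n → M)
    (hρ : ∀ σ : Equiv.Perm (Fin n),
      ∑ t : Fin n, ρ ((univ.filter fun i : Fin n => (i : ℕ) < (t : ℕ)).image σ) (σ t) = 0)
    {σ σ' : Equiv.Perm (Fin n)} {j : ℕ}
    (h : (univ.filter fun i : Fin n => (i : ℕ) < j).image σ =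
      (univ.filter fun i : Fin n => (i : ℕ) < j).image σ') :
    ∑ t ∈ univ.filter (fun t : Fin n => (t : ℕ) < j),
        ρ ((univ.filter fun i : Fin n => (i : ℕ) < t).image σ) (σ t) =
      ∑ t ∈ univ.filter (fun t : Fin n => (t : ℕ) < j),
        ρ ((univ.filter fun i : Fin n => (i : ℕ) < t).image σ') (σ' t) := by
  set f : Fin n → Fin n := fun i => if (i : ℕ) < j then σ' i else σ i with hf_def
  have hcross : ∀ i i' : Fin n, (i : ℕ) < j → ¬ (i' : ℕ) < j → σ' i ≠ σ i' := by
    intro i i' hi hi' hii'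
    have hmem : σ i' ∈ (univ.filter fun i : Fin n => (i : ℕ) < j).image σ := by
      rw [h, ← hii']
      exact mem_image_of_mem _ (mem_filter.mpr ⟨mem_univ _, hi⟩)
    rw [Grenet.mem_prefix_image, Equiv.symm_apply_apply] at hmem
    exact hi' hmem
  have hf : Function.Injective f := by
    intro i i' hii'
    simp only [hf_def] at hii'
    by_cases hi : (i : ℕ) < j <;> by_cases hi' : (i' : ℕ) < j
    · rw [if_pos hi, if_pos hi'] at hii'
      exact σ'.injective hii'
    · rw [if_pos hi, if_neg hi'] at hii'
      exact absurd hii' (hcross i i' hi hi')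
    · rw [if_neg hi, if_pos hi'] at hii'
      exact absurd hii'.symm (hcross i' i hi' hi)
    · rw [if_neg hi, if_neg hi'] at hii'
      exact σ.injective hii'
  set τ : Equiv.Perm (Fin n) := Equiv.ofBijective f (Finite.injective_iff_bijective.mp hf)
    with hτ_def
  have hτlt : ∀ i : Fin n, (i : ℕ) < j → τ i = σ' i := fun i hi => by
    rw [hτ_def, Equiv.ofBijective_apply, hf_def]
    exact if_pos hi
  have hτge : ∀ i : Fin n, j ≤ (i : ℕ) → τ i = σ i := fun i hi => by
    rw [hτ_def, Equiv.ofBijective_apply, hf_def]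
    exact if_neg (not_lt.mpr hi)
  have h1 := sum_prefix_eq_of_eqOn_ge ρ hρ hτge
  have h2 : ∑ t ∈ univ.filter (fun t : Fin n => (t : ℕ) < j),
        ρ ((univ.filter fun i : Fin n => (i : ℕ) < t).image τ) (τ t) =
      ∑ t ∈ univ.filter (fun t : Fin n => (t : ℕ) < j),
        ρ ((univ.filter fun i : Fin n => (i : ℕ) < t).image σ') (σ' t) := by
    refine sum_congr rfl fun t ht => ?_
    have htj : (t : ℕ) < j := (mem_filter.mp ht).2
    rw [Grenet.prefix_image_eq_of_eqOn_lt hτlt htj.le, hτlt t htj]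
  exact h1.symm.trans h2

/-- **Additive potentials on the Boolean lattice (block `W0`).** Let `ρ S k` (`k ∉ S`) be weights in an
additive commutative group on the arcs `S → insert k S` of the subset lattice of `Fin n` such that along
EVERY maximal chain `∅ → univ` (every ordering `σ` of `Fin n`) the weights sum to zero,
`Σₜ ρ (σ({i < t})) (σ t) = 0`.  Then `ρ` is a coboundary: there is a potential `μ` on the subsets with
`μ ∅ = 0`, `μ univ = 0` and `ρ S k = μ (insert k S) - μ S` for all `k ∉ S` (`μ S` = the partial sum of
any ordering with prefix set `S`, well defined by `sum_prefix_eq_of_prefix_image_eq`).  Additive twin of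
`Grenet.exists_potential_of_prod_prefix_eq_one`. [folklore] -/
theorem exists_addPotential_of_sum_prefix_eq_zero (ρ : Finset (Fin n) → Fin n → M)
    (hρ : ∀ σ : Equiv.Perm (Fin n),
      ∑ t : Fin n, ρ ((univ.filter fun i : Fin n => (i : ℕ) < (t : ℕ)).image σ) (σ t) = 0) :
    ∃ μ : Finset (Fin n) → M, μ ∅ = 0 ∧ μ univ = 0 ∧
      ∀ (S : Finset (Fin n)) (k : Fin n), k ∉ S → ρ S k = μ (insert k S) - μ S := by
  choose enum henum using Grenet.exists_perm_prefix_image_eq (n := n)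
  refine ⟨fun S => ∑ t ∈ univ.filter (fun t : Fin n => (t : ℕ) < S.card),
      ρ ((univ.filter fun i : Fin n => (i : ℕ) < t).image (enum S)) (enum S t), ?_, ?_, ?_⟩
  · simp only [card_empty, Nat.not_lt_zero, filter_false, sum_empty]
  · dsimp only
    have hall : (univ.filter fun t : Fin n => (t : ℕ) < (univ : Finset (Fin n)).card) = univ := by
      ext t
      simp only [mem_filter, mem_univ, true_and, card_univ, Fintype.card_fin, t.isLt]
    rw [hall]
    exact hρ (enum univ)
  · intro S k hk
    obtain ⟨σ, hσ, hlt, hσk⟩ := Grenet.exists_perm_prefix_image_insert (henum S) hk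
    have hσ1 : (univ.filter fun i : Fin n => (i : ℕ) < (insert k S).card).image σ = insert k S := by
      rw [card_insert_of_notMem hk, Grenet.prefix_image_succ σ hlt, hσk, hσ]
    dsimp only
    rw [sum_prefix_eq_of_prefix_image_eq ρ hρ ((henum (insert k S)).trans hσ1.symm),
      sum_prefix_eq_of_prefix_image_eq ρ hρ ((henum S).trans hσ.symm),
      card_insert_of_notMem hk]
    have hsplit : (univ.filter fun t : Fin n => (t : ℕ) < S.card + 1) =
        insert (⟨S.card, hlt⟩ : Fin n) (univ.filter fun t : Fin n => (t : ℕ) < S.card) := by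
      ext i
      simp only [mem_filter, mem_univ, true_and, mem_insert, Fin.ext_iff]
      omega
    have hnot : (⟨S.card, hlt⟩ : Fin n) ∉ univ.filter fun t : Fin n => (t : ℕ) < S.card := by
      simp
    have hpre :
        (univ.filter fun i : Fin n => (i : ℕ) < ((⟨S.card, hlt⟩ : Fin n) : ℕ)).image σ = S :=
      hσ
    rw [hsplit, sum_insert hnot, hpre, hσk, add_sub_cancel_right]

end Summit.ValiantsHypothesis.Theorems.RigidityForcesSymmetry.GrenetGauge
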